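import Mathlib
import HarnessLib

/-!
# Numeric evaluation of the real powers in the window certificate (route `BarrierStepRungThree`)

Supports items stmt-NavierStokesRegularity-23420 / 23942.  The clauses of the repaired certificate format
and the side conditions of the profile kit (`CertificateProfile.certificateProfileKit`,
`taoLadderRungThree_target_of_boxCertificateKit`) carry the lattice rates and restart weights as REAL
powers of `2` — `(1+1)^{5k/2}`, `(1+1)^{2k}`, `(1+1)^{-θ}`, `2^{2θ}`, `2^{-5/2}` — which `norm_num` does not
evaluate.  For a concrete certificate (integer window shells, and the recommended ratio exponent
`θ = 1/2`, the weakest goal threshold `|S_{i₀,1}| ≥ 2^{-1/2}` the restart bookkeeping allows) every such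
power is an INTEGER power of `√2`.  This file records the conversions once:

* `two_rpow_half_int` — `2^{k/2} = (√2)^k` for every integer `k` (as a `zpow`), and the special cases
  `two_rpow_five_halves_int` (`2^{5k/2} = (√2)^{5k}`), `one_add_one_rpow_two_mul_int`
  (`(1+1)^{2k} = 2^{2k}`);
* `θ = 1/2`: `two_rpow_neg_half`, `one_add_one_rpow_neg_half` (`= (√2)⁻¹`), `two_rpow_two_mul_half`
  (`2^{2·(1/2)} = 2`), `two_rpow_half` (`= √2`);
* two-sided rational bounds `sqrt_two_gt`/`sqrt_two_lt` (`1.41421 < √2 < 1.41422`) and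
  `inv_sqrt_two_lt`/`inv_sqrt_two_gt` (`0.70710 < (√2)⁻¹ < 0.70711`) for the final `norm_num` steps.

HONEST FRAMING: elementary real-number identities for CHECKING a certificate about a Tao-type MODEL
lattice (rung TL-M3); nothing here concerns the Navier–Stokes equations; no summit is proved.
-/

noncomputable section

-- the sub-problem namespace repeats the summit name by design (D-0017)
set_option linter.dupNamespace false

namespace Summit.NavierStokesRegularity.NavierStokesRegularity.Theorems

namespace CertificateProfile

/-- `2^{k/2} = (√2)^k` for every integer `k`. [folklore] -/
theorem two_rpow_half_int (k : ℤ) : (2 : ℝ) ^ ((k : ℝ) / 2) = Real.sqrt 2 ^ k := by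
  rw [Real.sqrt_eq_rpow, ← Real.rpow_intCast, ← Real.rpow_mul zero_le_two]
  congr 1
  ring

/-- `2^{5k/2} = (√2)^{5k}` for every integer `k` (the lattice rate `Λ_k` at scale ratio `2`).
[cite: Tao2016AveragedNS, §4 (4.8) (the rate `(1+ε₀)^{5n/2}`)] -/
theorem two_rpow_five_halves_int (k : ℤ) :
    (2 : ℝ) ^ ((5 : ℝ) * (k : ℝ) / 2) = Real.sqrt 2 ^ (5 * k) := by
  rw [← two_rpow_half_int]
  congr 1
  push_cast
  ring

/-- The same with the base spelled `1 + 1` (as in the certificate clauses). [folklore] -/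
theorem one_add_one_rpow_five_halves_int (k : ℤ) :
    (1 + 1 : ℝ) ^ ((5 : ℝ) * (k : ℝ) / 2) = Real.sqrt 2 ^ (5 * k) := by
  rw [show (1 + 1 : ℝ) = 2 by norm_num, two_rpow_five_halves_int]

/-- `(1+1)^{2k} = 2^{2k}` (the defect weight `4^k`) as an integer power. [folklore] -/
theorem one_add_one_rpow_two_mul_int (k : ℤ) :
    (1 + 1 : ℝ) ^ ((2 : ℝ) * (k : ℝ)) = (2 : ℝ) ^ (2 * k) := by
  rw [show (1 + 1 : ℝ) = 2 by norm_num, show (2 : ℝ) * (k : ℝ) = ((2 * k : ℤ) : ℝ) by push_cast; ring,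
    Real.rpow_intCast]

/-- `(1+1)^{10k} = 2^{10k}` (the a-priori regularity weight (4.5)) as an integer power. [folklore] -/
theorem one_add_one_rpow_ten_mul_int (k : ℤ) :
    (1 + 1 : ℝ) ^ ((10 : ℝ) * (k : ℝ)) = (2 : ℝ) ^ (10 * k) := by
  rw [show (1 + 1 : ℝ) = 2 by norm_num, show (10 : ℝ) * (k : ℝ) = ((10 * k : ℤ) : ℝ) by push_cast; ring,
    Real.rpow_intCast]

/-- `2^{1/2} = √2`. [folklore] -/
theorem two_rpow_half : (2 : ℝ) ^ ((1 : ℝ) / 2) = Real.sqrt 2 := by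
  rw [Real.sqrt_eq_rpow]

/-- `2^{-1/2} = (√2)⁻¹` — the goal threshold for `θ = 1/2`. [folklore] -/
theorem two_rpow_neg_half : (2 : ℝ) ^ (-((1 : ℝ) / 2)) = (Real.sqrt 2)⁻¹ := by
  rw [Real.rpow_neg zero_le_two, two_rpow_half]

/-- `(1+1)^{-(1/2)} = (√2)⁻¹` — the goal threshold `(1+1)^{-θ}` of the certificate at `θ = 1/2`.
[cite: Tao2016AveragedNS, §6.2 Prop. 6.3 (the re-entry ratio `(1+ε₀)^{-θ}`)] -/
theorem one_add_one_rpow_neg_half : (1 + 1 : ℝ) ^ (-((1 : ℝ) / 2)) = (Real.sqrt 2)⁻¹ := by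
  rw [show (1 + 1 : ℝ) = 2 by norm_num, two_rpow_neg_half]

/-- `2^{2·(1/2)} = 2` (the square of the cap-growth factor at `θ = 1/2`). [folklore] -/
theorem two_rpow_two_mul_half : (2 : ℝ) ^ (2 * ((1 : ℝ) / 2)) = 2 := by
  norm_num

/-- `2^{1/2} ≤ λ G ↔ √2 ≤ λ G` packaging for the kit's `hlamG` at `θ = 1/2`. [folklore] -/
theorem two_rpow_half_le_iff (t : ℝ) : (2 : ℝ) ^ ((1 : ℝ) / 2) ≤ t ↔ Real.sqrt 2 ≤ t := by
  rw [two_rpow_half]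

/-- `2^{-5/2} = (√2)⁻¹ / 4` in the kit's spelling `2 ^ (-(5:ℝ)/2)`. [folklore] -/
theorem two_rpow_neg_five_halves' : (2 : ℝ) ^ (-(5 : ℝ) / 2) = (Real.sqrt 2) ^ (-5 : ℤ) := by
  rw [show (-(5 : ℝ) / 2) = (((-5 : ℤ) : ℝ) / 2) by push_cast; ring, two_rpow_half_int]

/-- `1.41421 < √2`. [folklore] -/
theorem sqrt_two_gt : (1.41421 : ℝ) < Real.sqrt 2 := by
  rw [show (1.41421 : ℝ) = Real.sqrt (1.41421 ^ 2) by rw [Real.sqrt_sq (by norm_num)]]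
  exact Real.sqrt_lt_sqrt (by norm_num) (by norm_num)

/-- `√2 < 1.41422`. [folklore] -/
theorem sqrt_two_lt : Real.sqrt 2 < (1.41422 : ℝ) := by
  rw [show (1.41422 : ℝ) = Real.sqrt (1.41422 ^ 2) by rw [Real.sqrt_sq (by norm_num)]]
  exact Real.sqrt_lt_sqrt (by norm_num) (by norm_num)

/-- `0.70710 < (√2)⁻¹`. [folklore] -/
theorem inv_sqrt_two_gt : (0.70710 : ℝ) < (Real.sqrt 2)⁻¹ := by
  rw [lt_inv_comm₀ (by norm_num) (Real.sqrt_pos.2 two_pos)]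
  calc Real.sqrt 2 < 1.41422 := sqrt_two_lt
    _ < (0.70710 : ℝ)⁻¹ := by norm_num

/-- `(√2)⁻¹ < 0.70711`. [folklore] -/
theorem inv_sqrt_two_lt : (Real.sqrt 2)⁻¹ < (0.70711 : ℝ) := by
  rw [inv_lt_comm₀ (Real.sqrt_pos.2 two_pos) (by norm_num)]
  calc (0.70711 : ℝ)⁻¹ < 1.41421 := by norm_num
    _ < Real.sqrt 2 := sqrt_two_gt

/-- Even integer powers of `√2`: `(√2)^{2m} = 2^m`. [folklore] -/
theorem sqrt_two_zpow_two_mul (m : ℤ) : Real.sqrt 2 ^ (2 * m) = (2 : ℝ) ^ m := by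
  rw [zpow_mul, zpow_two, Real.mul_self_sqrt zero_le_two]

/-- Odd integer powers of `√2`: `(√2)^{2m+1} = 2^m √2`. [folklore] -/
theorem sqrt_two_zpow_two_mul_add_one (m : ℤ) :
    Real.sqrt 2 ^ (2 * m + 1) = (2 : ℝ) ^ m * Real.sqrt 2 := by
  rw [zpow_add₀ (Real.sqrt_ne_zero'.2 two_pos), sqrt_two_zpow_two_mul, zpow_one]

end CertificateProfile

end Summit.NavierStokesRegularity.NavierStokesRegularity.Theorems

end
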